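import Mathlib
import Literature.Analysis.FluidPDE.KNSSLimitOseenIdentity
import Summits.NavierStokesRegularity.OSWSelfSimilar.TypeIIInnerLimitAlternative
import HarnessLib
/-!
# Type (α) sharpened: the degenerate inner object is ONE UNIT VECTOR with no azimuthal component
# (zone Z1 TEMPLATE §T1.4-I (I-4)(α) verbatim; kernel, unconditional)

HONEST FRAMING (cell ns-blowup GROUP B «PROFILE SEARCH», zone Z1; D-0035/D-0074): part XXVI of the Z1 dictionary. Parts
XIV–XXV render TEMPLATE (I-4)(α) as «`W(s, ·) ≡ W(s, 0)` on every slice» — a slice-wise constant `c(s)` with `‖c(s)‖ ≤ 1`,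
`sup‖c‖ = 1`. The TEMPLATE says more: «(α) a constant UNIT vector field (in Case A necessarily `W ≡ ±e_z`)». The missing
step is KNSS 2009 Remark 6.1 (an ancient MILD solution of the form `b(t)` is constant), which needs the Oseen integral
identity of the inner object — carried by the extraction (KNSS Lemma 6.1) but dropped by the packaged conclusions
`IsKNSSBlowupLimit W ∧ convergence`. With the tree's `oseenIdentity_of_tendstoLocallyUniformly_subseq` /
`eq_of_oseenIdentity_of_slice_const` / `IsKNSSBlowupLimit.norm_eq_one_of_const` (`KNSSLimitOseenIdentity`) this file
restores it from the zoom data and sharpens every (α) statement: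

* `zoom_limit_oseenIdentity` — the inner object of ANY gauge N-a zoom under the standing hypotheses (any centres)
  satisfies the Oseen integral identity between all `s < t < 0`;
* `innerLimit_unitStream_of_const` — hence a slice-wise constant inner object is ONE vector `c` with `‖c‖ = 1`;
  `innerLimit_axialUnitStream_of_const` — with axisymmetric slices (Case A) `c = β e_z`, `|β| = 1`, i.e. `W ≡ ±e_z`;
* `caseB_limit_apply_one_eq_zero` — in CASE B (`rₖ/λₖ → ∞`, meridional centres `rₖe₀ + zₖe₂`) the limit has NO
  AZIMUTHAL component at the centre: `(W(s, 0))₁ = 0` — because `λₖ u_θ(xₖ) = λₖ Γ(xₖ)/rₖ`, `|Γ| ≤ ‖Γ₀‖_∞` on the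
  lifespan (swirl maximum principle) and `rₖ/λₖ → ∞`;
* `innerLimit_refined_dichotomy_of_unbounded` — the Case-A/Case-B split with these riders: Case B ⇒ `W ≡ c`,
  `‖c‖ = 1`, `c₁ = 0` (a unit POLOIDAL stream in the receding frame); Case A ⇒ axisymmetric, `|Γ_W| ≤ Mₛ`, Oseen-mild;
* `innerLimit_unitStream_or_counterexample_of_singularity` — **THE SHARPENED CENSUS SENTENCE, UNCONDITIONAL**, on K8's
  standing hypotheses verbatim: the inner object of an axisymmetric singularity is EITHER one unit vector `c` with
  `c₁ = 0` (`W ≡ c`; axial `±e_z` in Case A) OR an (AX-L) counterexample with the (I-5) signature (part XXV).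

**Nothing here asserts that a singular solution exists or that (AX-L) holds or fails; implications on a hypothetical
singular solution only.** «violates: n/a — dictionary»; bears_on LADDER-NS N5/Z1 → N1 linear core / N0⁻ ((I-2)–(I-5)).
Author: ns-blowup-profile-eng-1 g8, 2026-08-27.
-/

open Real Filter Topology Set MeasureTheory Function Bornology
open scoped ENNReal NNReal
open Literature.Analysis.FluidPDE

namespace Summit.NavierStokesRegularity.OSWSelfSimilar
namespace TypeIIModulationDictionary

section UnitStream

variable {T Mₛ : ℝ} {u : ℝ → EuclideanSpace ℝ (Fin 3) → EuclideanSpace ℝ (Fin 3)}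
  {p : ℝ → EuclideanSpace ℝ (Fin 3) → ℝ} {W : ℝ → EuclideanSpace ℝ (Fin 3) → EuclideanSpace ℝ (Fin 3)}

/-- **The inner object of a gauge N-a zoom satisfies the Oseen integral identity.** Let `u` be classical (`ν = 1`,
unforced) on `[0, T⋆) × ℝ³`, bounded with bounded energy on closed sub-slabs; zoom data `tₖ ∈ [t₁, T⋆)` (`t₁ > 0`),
`λₖ > 0`, `λₖ → 0`, `λₖ‖u‖ ≤ 1` on `[0, tₖ]`, ANY centres `xₖ`; if along a strictly increasing `φ` the zoom slices
`y ↦ λ_{φk} u(t_{φk} + λ_{φk}² s, x_{φk} + λ_{φk} y)` converge locally uniformly for every `s < 0` to `W(s, ·)`, `W` jointly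
continuous on `(−∞, 0) × ℝ³`, then `W(t) = e^{(t−s)Δ}W(s) − B¹_s(W, W)(t)` for all `s < t < 0` (parts XX
`zoom_isClassical`/`zoom_oseenMild` + the tree's `oseenIdentity_of_tendstoLocallyUniformly_subseq`). [new here — dictionary] -/
theorem zoom_limit_oseenIdentity (hu : IsClassicalNSSolutionOn (Ico 0 T) 1 0 u p)
    (hE : ∀ S < T, ∃ C : ℝ≥0∞, C < ⊤ ∧ ∀ t ∈ Icc 0 S, ∫⁻ x, ‖u t x‖ₑ ^ 2 ≤ C)
    (hbdd : ∀ S < T, ∃ N : ℝ, 0 < N ∧ ∀ t ∈ Icc 0 S, ∀ x, ‖u t x‖ ≤ N)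
    {tn lamn : ℕ → ℝ} {xn : ℕ → EuclideanSpace ℝ (Fin 3)} {t₁ : ℝ} (ht₁ : 0 < t₁)
    (htn : ∀ k, t₁ ≤ tn k ∧ tn k < T) (hlam : ∀ k, 0 < lamn k) (hlam0 : Tendsto lamn atTop (𝓝 0))
    (hgauge : ∀ k, ∀ t ∈ Icc 0 (tn k), ∀ x, lamn k * ‖u t x‖ ≤ 1) {φ : ℕ → ℕ} (hφ : StrictMono φ)
    (hWc : ContinuousOn (uncurry W) (Iio 0 ×ˢ univ))
    (hconv : ∀ s < 0, TendstoLocallyUniformly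
      (fun k => (lamn (φ k) • stPull (lamn (φ k) ^ 2) (lamn (φ k)) (tn (φ k)) (xn (φ k)) u) s) (W s) atTop) :
    ∀ s t : ℝ, s < t → t < 0 → ∀ x,
      W t x = Literature.Analysis.UnboundedOperators.heatExtension (W s) (t - s) x - oseenDuhamel 1 s W W t x := by
  set A : ℕ → ℝ := fun k => -tn k / lamn k ^ 2 with hA
  set B : ℕ → ℝ := fun k => (T - tn k) / lamn k ^ 2 with hB
  have hBpos : ∀ k, 0 < B k := fun k => div_pos (sub_pos.2 (htn k).2) (pow_pos (hlam k) 2)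
  have hAlim : Tendsto A atTop atBot := by
    have hl2 : Tendsto (fun k => lamn k ^ 2) atTop (𝓝[>] 0) := by
      refine tendsto_nhdsWithin_iff.2 ⟨by simpa using hlam0.pow 2, Eventually.of_forall fun k => ?_⟩
      exact pow_pos (hlam k) 2
    have hinv : Tendsto (fun k => (lamn k ^ 2)⁻¹) atTop atTop := tendsto_inv_nhdsGT_zero.comp hl2
    have hmaj : Tendsto (fun k => -t₁ * (lamn k ^ 2)⁻¹) atTop atBot :=
      hinv.const_mul_atTop_of_neg (by linarith)
    refine tendsto_atBot_mono (fun k => ?_) hmaj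
    have hl2k : 0 < lamn k ^ 2 := pow_pos (hlam k) 2
    show -tn k / lamn k ^ 2 ≤ -t₁ * (lamn k ^ 2)⁻¹
    rw [div_eq_mul_inv]
    exact mul_le_mul_of_nonneg_right (by linarith [(htn k).1]) (inv_nonneg.2 hl2k.le)
  have hbd1 : ∀ k, ∀ τ ∈ Ioo (A k) 0, ∀ x,
      ‖(lamn k • stPull (lamn k ^ 2) (lamn k) (tn k) (xn k) u) τ x‖ ≤ 1 := by
    intro k τ hτ x
    have hl2k : 0 < lamn k ^ 2 := pow_pos (hlam k) 2
    have h1 : 0 ≤ tn k + lamn k ^ 2 * τ := by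
      have : -tn k / lamn k ^ 2 < τ := hτ.1
      rw [div_lt_iff₀ hl2k] at this; linarith
    have h2 : tn k + lamn k ^ 2 * τ ≤ tn k := by nlinarith [hτ.2]
    have h := hgauge k (tn k + lamn k ^ 2 * τ) ⟨h1, h2⟩ (xn k + lamn k • x)
    simpa [stPull_apply, norm_smul, abs_of_pos (hlam k)] using h
  exact oseenIdentity_of_tendstoLocallyUniformly_subseq (A := A) (B := B)
    (w := fun k => lamn k • stPull (lamn k ^ 2) (lamn k) (tn k) (xn k) u)
    (q := fun k => lamn k ^ 2 • stPull (lamn k ^ 2) (lamn k) (tn k) (xn k) p) zero_le_one hAlim hBpos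
    (fun k => zoom_isClassical hu (hlam k) (tn k) (xn k))
    (fun k s t hs hst ht x => zoom_oseenMild hu hE hbdd (hlam k) (tn k) (xn k) hs hst ht x) hbd1 hφ hWc hconv

/-- **TEMPLATE (I-4)(α) AS PRINTED: a slice-wise constant inner object is ONE UNIT VECTOR.** A KNSS blow-up limit `W`
with the Oseen identity and `W(s, ·) ≡ W(s, 0)` for every `s < 0` is one constant `c` on `(−∞, 0) × ℝ³` with
`‖c‖ = 1` (KNSS Remark 6.1 via the tree's `eq_of_oseenIdentity_of_slice_const`, and `|W| ≤ 1 = sup|W|`).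
[new here — dictionary] -/
theorem innerLimit_unitStream_of_const (hW : IsKNSSBlowupLimit W)
    (hmild : ∀ s t : ℝ, s < t → t < 0 → ∀ x,
      W t x = Literature.Analysis.UnboundedOperators.heatExtension (W s) (t - s) x - oseenDuhamel 1 s W W t x)
    (hconst : ∀ s < 0, ∀ y : EuclideanSpace ℝ (Fin 3), W s y = W s 0) :
    ∃ c : EuclideanSpace ℝ (Fin 3), ‖c‖ = 1 ∧ ∀ s < 0, ∀ y : EuclideanSpace ℝ (Fin 3), W s y = c := by
  have h := eq_of_oseenIdentity_of_slice_const hmild hconst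
  have hc : ∀ s < 0, ∀ y : EuclideanSpace ℝ (Fin 3), W s y = W (-1) 0 := fun s hs y => h s hs (-1) (by norm_num) y
  exact ⟨W (-1) 0, hW.norm_eq_one_of_const hc, hc⟩

/-- **(I-4)(α) in CASE A, as printed: `W ≡ ±e_z`.** With axisymmetric slices the unit vector is AXIAL: `c = β e_z`,
`|β| = 1` (part XXIV `apply_eq_smul_eZ_of_isAxisymmetric_of_const`). [new here — dictionary] -/
theorem innerLimit_axialUnitStream_of_const (hW : IsKNSSBlowupLimit W)
    (hmild : ∀ s t : ℝ, s < t → t < 0 → ∀ x,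
      W t x = Literature.Analysis.UnboundedOperators.heatExtension (W s) (t - s) x - oseenDuhamel 1 s W W t x)
    (hax : ∀ s < 0, IsAxisymmetric (W s)) (hconst : ∀ s < 0, ∀ y : EuclideanSpace ℝ (Fin 3), W s y = W s 0) :
    ∃ β : ℝ, |β| = 1 ∧ ∀ s < 0, ∀ y : EuclideanSpace ℝ (Fin 3), W s y = β • eZ := by
  obtain ⟨c, hc1, hc⟩ := innerLimit_unitStream_of_const hW hmild hconst
  have hax' : c = (c 2) • eZ := by
    have h := apply_eq_smul_eZ_of_isAxisymmetric_of_const (hax (-1) (by norm_num)) (hconst (-1) (by norm_num))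
    rwa [hc (-1) (by norm_num) 0] at h
  refine ⟨c 2, ?_, fun s hs y => by rw [hc s hs y, ← hax']⟩
  have : ‖c‖ = |c 2| := by
    rw [hax', norm_smul, Real.norm_eq_abs]
    simp [eZ]
  rw [← this, hc1]

/-- **CASE B: the limit has NO AZIMUTHAL component at the centre.** Let `u` be classical (`ν = 1`, unforced) on `[0, T⋆)`
with axisymmetric slices, bounded on closed sub-slabs, with `|Γ(0, ·)| ≤ Mₛ`; zoom data `tₖ ∈ [t₁, T⋆)` (`t₁ > 0`),
`λₖ > 0`, `λₖ → 0`, meridional centres `xₖ = rₖ e₀ + zₖ e₂`, `λₖ‖u(tₖ, xₖ)‖ → 1` (so `tₖ → T⋆`), and CASE B `rₖ/λₖ → ∞`.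
If along `φ` the zoom slices converge locally uniformly to `W(s, ·)`, then `(W(s, 0))₁ = 0` for every `s < 0`: at the
centre `(λₖ u)₁ = λₖ Γ(xₖ)/rₖ` (on the meridional half-plane `e_θ = e₁`), `|Γ| ≤ Mₛ` on `[0, T⋆)` by the swirl maximum
principle (`abs_swirl_le_of_classical_Ico`), and `λₖ/rₖ → 0`. The Case-B stream is POLOIDAL in the receding frame.
[new here — dictionary] -/
theorem caseB_limit_apply_one_eq_zero (hT : 0 < T) (hu : IsClassicalNSSolutionOn (Ico 0 T) 1 0 u p)
    (haxi : ∀ t, IsAxisymmetric (u t)) (hbdd : ∀ S < T, ∃ N : ℝ, 0 < N ∧ ∀ t ∈ Icc 0 S, ∀ x, ‖u t x‖ ≤ N)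
    (hMₛ : ∀ x, |swirl (u 0) x| ≤ Mₛ)
    {tn lamn rn zn : ℕ → ℝ} {t₁ : ℝ} (ht₁ : 0 < t₁) (htn : ∀ k, t₁ ≤ tn k ∧ tn k < T)
    (hlam : ∀ k, 0 < lamn k) (hlam0 : Tendsto lamn atTop (𝓝 0))
    (hnear : Tendsto (fun k => lamn k *
      ‖u (tn k) (EuclideanSpace.single 0 (rn k) + EuclideanSpace.single 2 (zn k))‖) atTop (𝓝 1))
    (hcaseB : Tendsto (fun k => rn k / lamn k) atTop atTop) {φ : ℕ → ℕ} (hφ : StrictMono φ)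
    (hconv : ∀ s < 0, TendstoLocallyUniformly
      (fun k => (lamn (φ k) • stPull (lamn (φ k) ^ 2) (lamn (φ k)) (tn (φ k))
        (EuclideanSpace.single 0 (rn (φ k)) + EuclideanSpace.single 2 (zn (φ k))) u) s) (W s) atTop) :
    ∀ s < 0, W s 0 1 = 0 := by
  intro s hs
  set xn : ℕ → EuclideanSpace ℝ (Fin 3) := fun k => EuclideanSpace.single 0 (rn k) + EuclideanSpace.single 2 (zn k)
    with hxn
  -- the centre values of the zoom converge to `W s 0`; take the component `1`
  have hpt : Tendsto (fun k => lamn (φ k) • u (tn (φ k) + lamn (φ k) ^ 2 * s) (xn (φ k))) atTop (𝓝 (W s 0)) := by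
    have h := ((hconv s hs).tendstoLocallyUniformlyOn (s := univ)).tendsto_at (mem_univ 0)
    exact h.congr fun k => by simp [hxn, stPull_apply]
  have hpt1 : Tendsto (fun k => lamn (φ k) * u (tn (φ k) + lamn (φ k) ^ 2 * s) (xn (φ k)) 1) atTop
      (𝓝 (W s 0 1)) := by
    have h := ((PiLp.continuous_apply 2 (fun _ : Fin 3 => ℝ) 1).tendsto _).comp hpt
    exact h.congr fun k => by simp
  -- the competing limit `0`
  have htT : Tendsto tn atTop (𝓝 T) :=
    tendsto_tn_of_zoom_data hbdd (fun k => ⟨ht₁.le.trans (htn k).1, (htn k).2⟩) hlam hlam0 hnear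
  have hmem : ∀ᶠ k in atTop, tn (φ k) + lamn (φ k) ^ 2 * s ∈ Ico 0 T :=
    eventually_mem_Ico_of_tendsto_zoom hT (htT.comp hφ.tendsto_atTop) (fun k => (htn (φ k)).2)
      (hlam0.comp hφ.tendsto_atTop) hs.le
  have hrpos : ∀ᶠ k in atTop, 0 < rn (φ k) := by
    have h := (hcaseB.comp hφ.tendsto_atTop).eventually (eventually_gt_atTop (0 : ℝ))
    filter_upwards [h] with k hk
    have hk' : 0 < rn (φ k) / lamn (φ k) := hk
    by_contra hle
    exact absurd hk' (not_lt.2 (div_nonpos_of_nonpos_of_nonneg (not_lt.1 hle) (hlam (φ k)).le))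
  have hswirl : ∀ t ∈ Ico 0 T, ∀ x, |swirl (u t) x| ≤ Mₛ :=
    abs_swirl_le_of_classical_Ico one_pos hu (fun t _ => haxi t)
      (fun S hS => (hbdd S hS).imp fun N hN => hN.2) hMₛ
  -- `|λ u₁(x_k)| = λ |Γ(x_k)| / r_k ≤ Mₛ λ_k / r_k`
  have hbound : ∀ᶠ k in atTop,
      |lamn (φ k) * u (tn (φ k) + lamn (φ k) ^ 2 * s) (xn (φ k)) 1| ≤ Mₛ * (lamn (φ k) / rn (φ k)) := by
    filter_upwards [hmem, hrpos] with k hk hr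
    have hsw := hswirl _ hk (xn (φ k))
    have hx0 : xn (φ k) 0 = rn (φ k) := by simp [hxn]
    have hx1 : xn (φ k) 1 = 0 := by simp [hxn]
    have hΓ : swirl (u (tn (φ k) + lamn (φ k) ^ 2 * s)) (xn (φ k)) =
        rn (φ k) * u (tn (φ k) + lamn (φ k) ^ 2 * s) (xn (φ k)) 1 := by
      rw [swirl, hx0, hx1, zero_mul, sub_zero]
    rw [hΓ, abs_mul, abs_of_pos hr] at hsw
    rw [abs_mul, abs_of_pos (hlam (φ k))]
    have hu1 : |u (tn (φ k) + lamn (φ k) ^ 2 * s) (xn (φ k)) 1| ≤ Mₛ / rn (φ k) := by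
      rw [le_div_iff₀ hr]; linarith
    calc lamn (φ k) * |u (tn (φ k) + lamn (φ k) ^ 2 * s) (xn (φ k)) 1|
        ≤ lamn (φ k) * (Mₛ / rn (φ k)) := mul_le_mul_of_nonneg_left hu1 (hlam (φ k)).le
      _ = Mₛ * (lamn (φ k) / rn (φ k)) := by ring
  have hmaj : Tendsto (fun k => Mₛ * (lamn (φ k) / rn (φ k))) atTop (𝓝 0) := by
    have hinv : Tendsto (fun k => lamn (φ k) / rn (φ k)) atTop (𝓝 0) := by
      have h := (hcaseB.comp hφ.tendsto_atTop).inv_tendsto_atTop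
      exact h.congr fun k => by simp [inv_div]
    simpa using hinv.const_mul Mₛ
  have hzero : Tendsto (fun k => lamn (φ k) * u (tn (φ k) + lamn (φ k) ^ 2 * s) (xn (φ k)) 1) atTop (𝓝 0) :=
    squeeze_zero_norm' (by simpa only [Real.norm_eq_abs] using hbound) hmaj
  exact tendsto_nhds_unique hpt1 hzero

/-- **The refined (I-3) dichotomy from the standing hypotheses + unboundedness, NO conjecture.** As part XXV's
`innerLimit_dichotomy_of_unbounded`, with the riders of this file: the inner object `W` satisfies the Oseen identity, and
CASE B yields ONE unit vector with no azimuthal component (`W ≡ c`, `‖c‖ = 1`, `c₁ = 0`), CASE A yields axisymmetric slices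
with `|Γ_W| ≤ Mₛ`. [new here — dictionary; unconditional] -/
theorem innerLimit_refined_dichotomy_of_unbounded (hT : 0 < T) (hu : IsClassicalNSSolutionOn (Ico 0 T) 1 0 u p)
    (haxi : ∀ t, IsAxisymmetric (u t))
    (hE : ∀ S < T, ∃ C : ℝ≥0∞, C < ⊤ ∧ ∀ t ∈ Icc 0 S, ∫⁻ x, ‖u t x‖ₑ ^ 2 ≤ C)
    (hbdd : ∀ S < T, ∃ N : ℝ, 0 < N ∧ ∀ t ∈ Icc 0 S, ∀ x, ‖u t x‖ ≤ N) (hMₛ : ∀ x, |swirl (u 0) x| ≤ Mₛ)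
    (hunb : ∀ N : ℝ, ∃ t ∈ Ico 0 T, ∃ x : EuclideanSpace ℝ (Fin 3), N < ‖u t x‖) :
    ∃ (tn lamn : ℕ → ℝ) (cn : ℕ → EuclideanSpace ℝ (Fin 3)) (φ : ℕ → ℕ)
      (W : ℝ → EuclideanSpace ℝ (Fin 3) → EuclideanSpace ℝ (Fin 3)),
      (∀ k, T / 2 ≤ tn k ∧ tn k < T) ∧ (∀ k, 0 < lamn k) ∧ Tendsto lamn atTop (𝓝 0) ∧
      (∀ k, ∀ t ∈ Icc 0 (tn k), ∀ x, lamn k * ‖u t x‖ ≤ 1) ∧ StrictMono φ ∧ IsKNSSBlowupLimit W ∧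
      (∀ s < 0, TendstoLocallyUniformly
        (fun k => (lamn (φ k) • stPull (lamn (φ k) ^ 2) (lamn (φ k)) (tn (φ k)) (cn (φ k)) u) s) (W s) atTop) ∧
      (∀ s t : ℝ, s < t → t < 0 → ∀ x,
        W t x = Literature.Analysis.UnboundedOperators.heatExtension (W s) (t - s) x - oseenDuhamel 1 s W W t x) ∧
      ((∃ c : EuclideanSpace ℝ (Fin 3), ‖c‖ = 1 ∧ c 1 = 0 ∧ ∀ s < 0, ∀ y : EuclideanSpace ℝ (Fin 3), W s y = c) ∨
        ((∀ s < 0, IsAxisymmetric (W s)) ∧ ∀ s < 0, ∀ y : EuclideanSpace ℝ (Fin 3), |swirl (W s) y| ≤ Mₛ)) := by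
  obtain ⟨tn, lamn, rn, zn, htn, hlam, hlam0, hrn, hgauge, hnear⟩ :=
    exists_meridional_zoom_data_of_unbounded hT haxi hbdd hunb
  have hT2 : 0 < T / 2 := by positivity
  by_cases hbA : BddAbove (Set.range fun k => rn k / lamn k)
  · -- Case A along a subsequence: `rₖ/λₖ → d`
    obtain ⟨C, hC⟩ := hbA
    obtain ⟨d, -, ψ, hψ, hd⟩ := tendsto_subseq_of_bounded (Metric.isBounded_Icc (0 : ℝ) C)
      (x := fun k => rn k / lamn k) fun k => ⟨div_nonneg (hrn k) (hlam k).le, hC ⟨k, rfl⟩⟩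
    obtain ⟨φ, W, hφ, hW, hconv, hax, hsw⟩ :=
      innerLimit_caseA_data_standing hT hu haxi hE hbdd hMₛ
        (tn := tn ∘ ψ) (lamn := lamn ∘ ψ) (rn := rn ∘ ψ) (zn := zn ∘ ψ) hT2 (fun k => htn (ψ k))
        (fun k => hlam (ψ k)) (hlam0.comp hψ.tendsto_atTop) (fun k => hgauge (ψ k))
        (hnear.comp hψ.tendsto_atTop) hd
    have hmild := zoom_limit_oseenIdentity hu hE hbdd (tn := tn ∘ ψ) (lamn := lamn ∘ ψ)
      (xn := fun k => EuclideanSpace.single 2 (zn (ψ k))) hT2 (fun k => htn (ψ k)) (fun k => hlam (ψ k))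
      (hlam0.comp hψ.tendsto_atTop) (fun k => hgauge (ψ k)) hφ hW.smooth.continuousOn hconv
    exact ⟨tn, lamn, fun k => EuclideanSpace.single 2 (zn k), ψ ∘ φ, W, htn, hlam, hlam0, hgauge,
      hψ.comp hφ, hW, hconv, hmild, Or.inr ⟨hax, hsw⟩⟩
  · -- Case B along a subsequence: `rₖ/λₖ → ∞` (part XXI, unconditional) + the riders
    obtain ⟨ψ, hψ, hd⟩ := exists_subseq_tendsto_atTop_of_not_bddAbove hbA
    obtain ⟨φ, W, hφ, hW, hconv, hconst⟩ :=
      innerLimit_const_caseB_standing hu haxi hE hbdd (tn := tn ∘ ψ) (lamn := lamn ∘ ψ) (rn := rn ∘ ψ)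
        (zn := zn ∘ ψ) hT2 (fun k => htn (ψ k)) (fun k => hlam (ψ k)) (hlam0.comp hψ.tendsto_atTop)
        (fun k => hgauge (ψ k)) (hnear.comp hψ.tendsto_atTop) hd
    have hmild := zoom_limit_oseenIdentity hu hE hbdd (tn := tn ∘ ψ) (lamn := lamn ∘ ψ)
      (xn := fun k => EuclideanSpace.single 0 (rn (ψ k)) + EuclideanSpace.single 2 (zn (ψ k))) hT2
      (fun k => htn (ψ k)) (fun k => hlam (ψ k)) (hlam0.comp hψ.tendsto_atTop) (fun k => hgauge (ψ k)) hφ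
      hW.smooth.continuousOn hconv
    have h1 := caseB_limit_apply_one_eq_zero hT hu haxi hbdd hMₛ (tn := tn ∘ ψ) (lamn := lamn ∘ ψ)
      (rn := rn ∘ ψ) (zn := zn ∘ ψ) hT2 (fun k => htn (ψ k)) (fun k => hlam (ψ k))
      (hlam0.comp hψ.tendsto_atTop) (hnear.comp hψ.tendsto_atTop) hd hφ hconv
    obtain ⟨c, hc1, hc⟩ := innerLimit_unitStream_of_const hW hmild hconst
    refine ⟨tn, lamn, fun k => EuclideanSpace.single 0 (rn k) + EuclideanSpace.single 2 (zn k), ψ ∘ φ, W, htn,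
      hlam, hlam0, hgauge, hψ.comp hφ, hW, hconv, hmild, Or.inl ⟨c, hc1, ?_, hc⟩⟩
    rw [← hc (-1) (by norm_num) 0]
    exact h1 (-1) (by norm_num)

/-- **THE SHARPENED Z1 CENSUS SENTENCE BY DECL, UNCONDITIONAL: unit stream OR (AX-L) counterexample.** On K8's standing
hypotheses verbatim — `IsMaximalSmoothSolution 1 0 u p T⋆` (`T⋆ > 0`), `IsLerayHopfOn T⋆ 1 0 (u 0) u`, bounded on every
closed sub-slab, axisymmetric slices, `|Γ(0, ·)| ≤ Mₛ` — there are gauge N-a zoom data `tₖ ∈ [T⋆/2, T⋆)`, `λₖ > 0`,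
`λₖ → 0`, centres `cₖ` (`λₖ‖u‖ ≤ 1` on `[0, tₖ]`) and a subsequence along which `y ↦ λₖ u(tₖ + λₖ² s, cₖ + λₖ y)` converges
slice-wise locally uniformly to a KNSS blow-up limit `W` (`|W| ≤ 1 = sup|W|`, smooth bounded ancient mild, WITH the Oseen
identity) such that EITHER
(α) `W ≡ c` on `(−∞, 0) × ℝ³` for ONE vector `c` with `‖c‖ = 1` and `c₁ = 0` — a unit uniform stream with no azimuthal
component (TEMPLATE (I-4)(α) «a constant unit vector field»; AXIAL `c = ±e_z` when the slices are axisymmetric, Case A —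
`innerLimit_axialUnitStream_of_const`); OR
(β) `AxisymmetricLiouvilleBoundedSwirl` FAILS, witnessed by `W` (axisymmetric slices, `|Γ_W| ≤ Mₛ`, one non-constant
slice), and `W` carries swirl, has `r‖W_pol‖` unbounded (`violates: V-CR`), `Γ_W ∉ L^∞_s L^p` (`1 ≤ p < ∞`), `Γ_W`
non-decaying at radial infinity (part XXIV, all from DISCHARGED theorems). [new here — dictionary; unconditional] -/
theorem innerLimit_unitStream_or_counterexample_of_singularity (hT : 0 < T) (hmax : IsMaximalSmoothSolution 1 0 u p T)
    (hLH : IsLerayHopfOn T 1 0 (u 0) u) (hbdd : ∀ S < T, ∃ N : ℝ, 0 < N ∧ ∀ t ∈ Icc 0 S, ∀ x, ‖u t x‖ ≤ N)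
    (haxi : ∀ t, IsAxisymmetric (u t)) (hMₛ : ∀ x, |swirl (u 0) x| ≤ Mₛ) :
    ∃ (tn lamn : ℕ → ℝ) (cn : ℕ → EuclideanSpace ℝ (Fin 3)) (φ : ℕ → ℕ)
      (W : ℝ → EuclideanSpace ℝ (Fin 3) → EuclideanSpace ℝ (Fin 3)),
      (∀ k, T / 2 ≤ tn k ∧ tn k < T) ∧ (∀ k, 0 < lamn k) ∧ Tendsto lamn atTop (𝓝 0) ∧
      (∀ k, ∀ t ∈ Icc 0 (tn k), ∀ x, lamn k * ‖u t x‖ ≤ 1) ∧ StrictMono φ ∧ IsKNSSBlowupLimit W ∧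
      (∀ s < 0, TendstoLocallyUniformly
        (fun k => (lamn (φ k) • stPull (lamn (φ k) ^ 2) (lamn (φ k)) (tn (φ k)) (cn (φ k)) u) s) (W s) atTop) ∧
      (∀ s t : ℝ, s < t → t < 0 → ∀ x,
        W t x = Literature.Analysis.UnboundedOperators.heatExtension (W s) (t - s) x - oseenDuhamel 1 s W W t x) ∧
      ((∃ c : EuclideanSpace ℝ (Fin 3), ‖c‖ = 1 ∧ c 1 = 0 ∧ ∀ s < 0, ∀ y : EuclideanSpace ℝ (Fin 3), W s y = c) ∨
        (¬ Summit.NavierStokesRegularity.NavierStokesRegularity.AxisymmetricLiouvilleBoundedSwirl ∧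
          (∀ s < 0, IsAxisymmetric (W s)) ∧ (∀ s < 0, ∀ y : EuclideanSpace ℝ (Fin 3), |swirl (W s) y| ≤ Mₛ) ∧
          (∃ s < 0, ∃ x : EuclideanSpace ℝ (Fin 3), W s x ≠ W s 0) ∧
          (∃ s < 0, ∃ x : EuclideanSpace ℝ (Fin 3), swirl (W s) x ≠ 0) ∧
          (∀ C : ℝ, ∃ s < 0, ∃ x : EuclideanSpace ℝ (Fin 3), C < cylRadius x * ‖poloidalPart (W s) x‖) ∧
          (∀ q : ℝ≥0∞, 1 ≤ q → q < ⊤ → ∀ K : ℝ≥0, ∃ s < 0, (K : ℝ≥0∞) < eLpNorm (swirl (W s)) q volume) ∧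
          ∃ ε : ℝ, 0 < ε ∧ ∀ R : ℝ, ∃ s < 0, ∃ x : EuclideanSpace ℝ (Fin 3),
            R ≤ cylRadius x ∧ ε < |swirl (W s) x|)) := by
  obtain ⟨tn, lamn, cn, φ, W, htn, hlam, hlam0, hgauge, hφ, hW, hconv, hmild, hcase⟩ :=
    innerLimit_refined_dichotomy_of_unbounded hT hmax.1 haxi (energyBound_of_lerayHopf hLH) hbdd hMₛ
      (unbounded_of_not_hasSmoothExtensionPast hT hmax.1 hLH hmax.2)
  refine ⟨tn, lamn, cn, φ, W, htn, hlam, hlam0, hgauge, hφ, hW, hconv, hmild, ?_⟩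
  rcases hcase with hB | ⟨hax, hsw⟩
  · exact Or.inl hB
  · by_cases hnc : ∃ s < 0, ∃ x : EuclideanSpace ℝ (Fin 3), W s x ≠ W s 0
    · have hsw' : ∃ C : ℝ, ∀ s < 0, ∀ x, |swirl (W s) x| ≤ C := ⟨Mₛ, hsw⟩
      exact Or.inr ⟨not_axisymmetricLiouville_of_innerLimit_typeBeta hW hax hsw' hnc, hax, hsw, hnc,
        typeBeta_exists_swirl_ne_zero hW hax hnc, knssBlowupLimit_VCR_poloidal hW hax hsw',
        fun q hq1 hq K => typeBeta_eLpNorm_swirl_unbounded hW hax hnc hq1 hq K,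
        typeBeta_swirl_not_decay hW hax hnc⟩
    · push Not at hnc
      obtain ⟨β, hβ, hWβ⟩ := innerLimit_axialUnitStream_of_const hW hmild hax hnc
      refine Or.inl ⟨β • eZ, ?_, by simp [eZ], hWβ⟩
      rw [norm_smul, Real.norm_eq_abs, hβ]
      simp [eZ]

end UnitStream

end TypeIIModulationDictionary
end Summit.NavierStokesRegularity.OSWSelfSimilar
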